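import Summits.BirchSwinnertonDyer.BirchSwinnertonDyer.Theorems.KolyvaginRoadThreeMethod2IsoOrdinary
import Summits.BirchSwinnertonDyer.BirchSwinnertonDyer.Theorems.AdditiveKolyvaginRoadLocalFrobenius
import HarnessLib

/-!
# Route `AdditiveKolyvaginRoad`, crux `KolyvaginPrimitiveAdditive` (item stmt-BirchSwinnertonDyer-20132):
# stub A1 `stub_rankLoweringAdditive` — TORIC classes at a level prime: a representative of the localisation valued in
# the augmentation subgroup, the isotropy `e(L, L) = 0` of a small subgroup for the local Weil cup product, and the two
# cardinality inputs at a Bertolini–Darmon admissible prime (`h⁰(K_w, E[p]) ≤ 1`, `#(F − 1)E[p] ≤ p`)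
# (cell `pub/bsd-wall`, lead prover `bsd-wall-akr-p1` g2; `--supports stmt-BirchSwinnertonDyer-20132`, helper;
# p-generic companion of koly g13's `KolyvaginRoadThreeMethod2IsoOrdinary.lean` ∕ `…LocalH0.lean`, ordinary ↦ TORIC)

WHY THIS FILE. The input (Iso) of akr-p1 g0's reduction `AdditiveKoly.selQP_rankLowering_of_localGlobal` (p511644) —
the Poitou–Tate see-saw for the `q`-relaxed level-raised space `SelRelQP (insert q n) {q}` — needs the local Weil terms
of two of its classes to vanish at every place `w ≠ v_q`. Outside the level this is the (discharged) Kummer isotropy;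
at the place `w` of a level prime `q' ∈ n` both classes satisfy the TORIC condition `toricLocalKer` of
`AdditiveKolyvaginRoadLevelDefs` (localisation represented by a cocycle valued in the augmentation subgroup
`I_Γ · E(K̄_w)[p]`), and the vanishing is `e(L, L) = 0` for the subgroup `L = I_{G_𝔓} · E[p] = (F − 1)E[p]`, cyclic of
order `p` at a BD-admissible prime (the `εq'`-eigenline of `ρ̄(Frob_{q'}) ∼ diag(ε, εq')`). This file proves, for an
elliptic curve `E = W` over a number field `K`, `n ≥ 1`, an arbitrary `K`-field `E`:
* `exists_valued_cocycle_of_mem_toricLocalKer` — for `x ∈ toricLocalKer W E n`, `res_E x` is the class of a cocycle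
  of the restricted module valued in the augmentation subgroup `⟨res τ · y − y⟩ ≤ E[n](K̄)` (transport along the
  torsion comparison `θ = torsionPointsEquiv`);
* `weilCupProduct_res_eq_zero_of_valued` — if the additive Weil pairing vanishes on `A × A` for a subgroup `A`, the
  local Weil cup product of two classes with `A`-valued representatives is `0` (the `2`-cochain
  `(a,b,c) ↦ e(ψ b − ψ a, χ c − χ b)` vanishes identically);
* `weilPairingHom_eq_zero_of_mem_of_card_le` — for prime `n = p` and `#A ≤ p` an alternating pairing vanishes on
  `A × A` (`A` is cyclic);
and, for `E/ℚ` base-changed to a quadratic field `K` and a Bertolini–Darmon admissible prime `q` with place `w`: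
* `natCard_invariants_le_of_admQ` — `#(E[p](K̄)|_{Γ_{K_w}})^{Γ_{K_w}} ≤ p` (the Frobenius `F` of the local picture
  moves a point: sibling `AdditiveKoly.exists_frob_of_isAdmissiblePrime`; `F = res σ`, Neukirch II (9.6); a proper
  subgroup of `(ℤ/p)²` has order `≤ p`) — the (H0) input of koly g13's `natCard_galoisCohomology_one_torsion_le_sq`;
* `natCard_augmentation_le_of_admQ` — `#⟨res τ · y − y⟩ ≤ p` (it is `(F − 1)E[p]`, sibling
  `ToricFrob.closure_decomposition_eq_range`, and `F` has a non-zero fixed point).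

HONEST FRAMING: theorems only; no definition, no named fact, no `sorry`; closes nothing; nothing is booked.

References: [cite: BertoliniDarmon2005, §2.2–§2.3 (H¹_ord), p. 18] [cite: WZhang2014, §4.1, Prop. 5.4, Notations (xiv)]
[cite: SilvermanAEC2009, Prop. III.8.1 (the Weil pairing is alternating)] [cite: NeukirchANT1999, Ch. II §9 (9.6)].
-/

-- single-conjunct summit: `Summit.BirchSwinnertonDyer.BirchSwinnertonDyer.…` repeats the name by design
set_option linter.dupNamespace false

noncomputable section

open scoped Classical

universe u

namespace Summit.BirchSwinnertonDyer.BirchSwinnertonDyer.Theorems.AdditiveKoly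

open CategoryTheory WeierstrassCurve Field Function NumberField IsDedekindDomain
open Literature.NumberTheory.EllipticCurves Literature.NumberTheory.GaloisRepresentations
open Literature.NumberTheory.GaloisRepresentations.DiscreteGaloisModule (mu MuCarrier)
open Summit.BirchSwinnertonDyer.Rank1Residual.X11b.Three.Koly.Method2
open scoped ContRepresentation

/-! ## §1 Toric classes: an augmentation-valued representative of the restriction, and isotropy -/

section Toric

variable {K : Type u} [Field K] [NumberField K] (W : WeierstrassCurve K) (n : ℕ) [NeZero n]
  [W.IsElliptic]
variable (E : Type u) [Field E] [Algebra K E]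

/-- **A toric class restricts to the class of an AUGMENTATION-valued cocycle.** For `x ∈ H¹(K, E[n])` in the toric
local condition at the `K`-field `E` (`toricLocalKer`: `torsionLocMap x` is represented by a cocycle `ψ'` of `Γ_E`
valued in the augmentation subgroup `⟨σ T − T⟩` of `E(K̄_E)[n]`), the restriction `res_E x` to the restricted module
`E[n](K̄)|_{Γ_E}` is the class of a cocycle `ψ` all of whose values lie in the augmentation subgroup
`⟨res σ · y − y⟩ ≤ E[n](K̄)` — namely `ψ = θ⁻¹ ∘ ψ'` for the (equivariant) torsion comparison
`θ : E[n](K̄) ≃ E(K̄_E)[n]`, the difference with `φ ∘ res` being the coboundary of `θ⁻¹ m`. Bertolini–Darmon's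
`H¹_ord = im H¹(K_q, F⁺)` read on representatives (port of koly g13's
`exists_invariant_cocycle_of_mem_ordinaryLocalKer`). [cite: BertoliniDarmon2005, §2.2–§2.3 (H¹_ord)] -/
theorem exists_valued_cocycle_of_mem_toricLocalKer
    {x : galH1Torsion W (n : ℤ)} (hx : x ∈ toricLocalKer W E (n : ℤ)) :
    ∃ ψ : contOneCocycles
        (DiscreteGaloisModule.toTopRep (GaloisRep.restrictField E (W.torsionGaloisModule n))),
      (∀ σ : absoluteGaloisGroup E, ψ.1 σ ∈ AddSubgroup.closure
        {m : geomTorsion W n | ∃ (τ : absoluteGaloisGroup E) (y : geomTorsion W n),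
          m = resGal (K := K) E τ • y - y}) ∧
      oneCocycleClass _ ψ = galoisCohomology.res (W.torsionGaloisModule n) E 1 x := by
  have hn : (n : ℤ) ≠ 0 := by exact_mod_cast NeZero.ne n
  set A : AddSubgroup (geomTorsion W n) := AddSubgroup.closure
    {m : geomTorsion W n | ∃ (τ : absoluteGaloisGroup E) (y : geomTorsion W n), m = resGal (K := K) E τ • y - y}
    with hAdef
  obtain ⟨φ, rfl⟩ :=
    oneCocycleClass_surjective (discreteTopRep (absoluteGaloisGroup K) (geomTorsion W n)) x
  -- unfold the toric condition: `loc_E [φ] = [ψ']` with `ψ'` augmentation-valued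
  change oneCocycleClass _ φ ∈ AddSubgroup.comap _ _ at hx
  rw [AddSubgroup.mem_comap] at hx
  obtain ⟨ψ', hψ'L, hψ'⟩ := hx
  -- `loc_E [φ] = [σ ↦ θ (φ (res σ))]`
  have hloc : W.torsionLocMap E (n : ℤ)
        (oneCocycleClass (discreteTopRep (absoluteGaloisGroup K) (geomTorsion W n)) φ) =
      oneCocycleClass (discreteTopRep (absoluteGaloisGroup E)
          (AddSubgroup.torsionBy (localPoints W E) (n : ℤ)))
        (contOneCocycles.pullback (resGal (K := K) E)
          (resHomOfEquivariant (resGal (K := K) E)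
            (torsionPointsMap W E n) (torsionPointsMap_smul W E n)) φ) :=
    map_oneCocycleClass _ _ _ φ
  rw [hloc, ← sub_eq_zero, ← oneCocycleClass_sub, oneCocycleClass_eq_zero_iff] at hψ'
  obtain ⟨m, hm⟩ := hψ'
  -- `hm σ : ψ' σ - θ (φ (res σ)) = σ • m - m`
  have hm' : ∀ σ : absoluteGaloisGroup E,
      ψ'.1 σ - torsionPointsMap W E n (φ.1 (resGal (K := K) E σ)) = σ • m - m := fun σ => hm σ
  set θ := W.torsionPointsEquiv (n : ℤ) (E := E) hn with hθ
  -- `θ⁻¹` maps the augmentation subgroup of `E(K̄_E)[n]` into `A`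
  have hθA : ∀ T ∈ augmentationPoints (absoluteGaloisGroup E) (AddSubgroup.torsionBy (localPoints W E) (n : ℤ)),
      θ.symm T ∈ A := by
    have hle : (augmentationPoints (absoluteGaloisGroup E)
        (AddSubgroup.torsionBy (localPoints W E) (n : ℤ))).map θ.symm.toAddMonoidHom ≤ A := by
      unfold augmentationPoints
      rw [AddSubgroup.map_le_iff_le_comap, AddSubgroup.closure_le]
      rintro T ⟨g, y, rfl⟩
      change θ.symm (g • y - y) ∈ A
      rw [map_sub, torsionPointsEquiv_symm_smul]
      exact AddSubgroup.subset_closure ⟨g, θ.symm y, rfl⟩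
    intro T hT
    exact hle ⟨T, hT, rfl⟩
  -- the cocycle `ψ = θ⁻¹ ∘ ψ'` of the restricted module
  have hcoc : ∀ g h : absoluteGaloisGroup E, ψ'.1 (g * h) = ψ'.1 g + g • ψ'.1 h := fun g h => ψ'.2 g h
  let ψ : contOneCocycles
      (DiscreteGaloisModule.toTopRep (GaloisRep.restrictField E (W.torsionGaloisModule n))) :=
    ⟨⟨fun σ => θ.symm (ψ'.1 σ), continuous_of_discreteTopology.comp ψ'.1.continuous⟩, fun g h => by
      change θ.symm (ψ'.1 (g * h)) = θ.symm (ψ'.1 g) + absGaloisRestrict K E g • θ.symm (ψ'.1 h)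
      rw [← resGal_eq_absGaloisRestrict, ← torsionPointsEquiv_symm_smul, ← map_add, hcoc g h]⟩
  have hψ : ∀ σ, ψ.1 σ = θ.symm (ψ'.1 σ) := fun σ => rfl
  refine ⟨ψ, fun σ => ?_, ?_⟩
  · -- values in `A`
    rw [hψ]
    exact hθA _ (hψ'L σ)
  · -- the class: `ψ - φ_E` is the coboundary of `θ⁻¹ m`
    rw [res_torsionGaloisModule_oneCocycleClass, ← sub_eq_zero, ← oneCocycleClass_sub,
      oneCocycleClass_eq_zero_iff]
    refine ⟨θ.symm m, fun g => ?_⟩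
    change θ.symm (ψ'.1 g) - φ.1 (absGaloisRestrict K E g) =
      absGaloisRestrict K E g • θ.symm m - θ.symm m
    rw [← resGal_eq_absGaloisRestrict, ← torsionPointsEquiv_symm_smul, ← map_sub, ← hm', map_sub]
    congr 1
    apply θ.injective
    rw [AddEquiv.apply_symm_apply, torsionPointsEquiv_apply]

variable (e : geomTorsion W n → geomTorsion W n → AlgebraicClosure K)
  (hμ : ∀ S T, e S T ^ n = 1)
  (hadd₁ : ∀ S₁ S₂ T, e (S₁ + S₂) T = e S₁ T * e S₂ T)
  (hadd₂ : ∀ S T₁ T₂, e S (T₁ + T₂) = e S T₁ * e S T₂)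
  (hgal : ∀ (σ : absoluteGaloisGroup K) (S T : geomTorsion W n), σ • e S T = e (σ • S) (σ • T))

omit [NumberField K] [W.IsElliptic] in
/-- **Two classes with representatives valued in an isotropic subgroup have vanishing local Weil cup product** (the
compactness of the absolute Galois groups and the finiteness of `E[n]`, local instances in the tree's cup-product
files, are taken as instance binders here). If
the additive Weil pairing `weilPairingHom` vanishes on `A × A` for a subgroup `A ≤ E[n](K̄)`, and `res_E y`,
`res_E z` are the classes of cocycles of `E[n](K̄)|_{Γ_E}` valued in `A`, then the cup product of `res_E y` and
`res_E z` for the restriction of `weilContPairing` to `Γ_E` (at a place: `weilContPairingLocal`) is `0`: the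
homogeneous `2`-cochain `(a,b,c) ↦ e(ψ b − ψ a, χ c − χ b)` (`ContPairing.cupTwoCochain`) is identically zero. With
`A` the augmentation subgroup this is the isotropy of the toric line `H¹_ord` at a level prime, the local input of
the see-saw at the places of the level (port of koly g13's `weilCupProduct_res_eq_zero_of_mem_ordinaryLocalKer`).
[cite: WZhang2014, §4.1, Prop. 5.4] [cite: BertoliniDarmon2005, §2.3] -/
theorem weilCupProduct_res_eq_zero_of_valued [CompactSpace (absoluteGaloisGroup K)]
    [CompactSpace (absoluteGaloisGroup E)] [Finite (geomTorsion W n)] (A : AddSubgroup (geomTorsion W n))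
    (hA : ∀ S ∈ A, ∀ T ∈ A, weilPairingHom W n e hμ hadd₁ hadd₂ S T = 0)
    {y z : galH1Torsion W (n : ℤ)}
    (hy : ∃ ψ : contOneCocycles
        (DiscreteGaloisModule.toTopRep (GaloisRep.restrictField E (W.torsionGaloisModule n))),
      (∀ σ : absoluteGaloisGroup E, ψ.1 σ ∈ A) ∧
        oneCocycleClass _ ψ = galoisCohomology.res (W.torsionGaloisModule n) E 1 y)
    (hz : ∃ ψ : contOneCocycles
        (DiscreteGaloisModule.toTopRep (GaloisRep.restrictField E (W.torsionGaloisModule n))),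
      (∀ σ : absoluteGaloisGroup E, ψ.1 σ ∈ A) ∧
        oneCocycleClass _ ψ = galoisCohomology.res (W.torsionGaloisModule n) E 1 z) :
    ((weilContPairing W n e hμ hadd₁ hadd₂ hgal).restrict (absGaloisRestrict K E)).cupProduct
      (galoisCohomology.res (W.torsionGaloisModule n) E 1 y)
      (galoisCohomology.res (W.torsionGaloisModule n) E 1 z) = 0 := by
  obtain ⟨ψy, hψy, hy'⟩ := hy
  obtain ⟨ψz, hψz, hz'⟩ := hz
  rw [← hy', ← hz']
  erw [ContPairing.cupProduct_oneCocycleClass]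
  -- the cup-product cochain vanishes identically: `e(A, A) = 1`
  have hcoch : ((weilContPairing W n e hμ hadd₁ hadd₂ hgal).restrict (absGaloisRestrict K E)).cupTwoCochain
        ψy ψz =
      ((weilContPairing W n e hμ hadd₁ hadd₂ hgal).restrict (absGaloisRestrict K E)).cupTwoCochain
        0 ψz := by
    apply Subtype.ext
    refine ContinuousMap.ext fun a => ContinuousMap.ext fun b => ContinuousMap.ext fun c => ?_
    rw [ContPairing.cupTwoCochain_apply, ContPairing.cupTwoCochain_apply]
    change weilPairingHom W n e hμ hadd₁ hadd₂ (ψy.1 b - ψy.1 a) (ψz.1 c - ψz.1 b) =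
      weilPairingHom W n e hμ hadd₁ hadd₂ ((0 : contOneCocycles _).1 b - (0 : contOneCocycles _).1 a)
        (ψz.1 c - ψz.1 b)
    have h0 : ∀ g : absoluteGaloisGroup E, (0 : contOneCocycles (TopRep.res
        (absGaloisRestrict K E : absoluteGaloisGroup E →* absoluteGaloisGroup K)
        (W.torsionGaloisModule n).toTopRep)).1 g = 0 := fun g => rfl
    rw [h0, h0, sub_zero, map_zero, AddMonoidHom.zero_apply,
      hA _ (sub_mem (hψy b) (hψy a)) _ (sub_mem (hψz c) (hψz b))]
  unfold ContPairing.cupClass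
  rw [cxClass_congr hcoch]
  exact ContPairing.cupClass_eq_zero_of_left _ 0 ψz (oneCocycleClass_zero _)

omit [NumberField K] in
/-- **`e(A, A) = 0` when `#A ≤ p`.** For a prime level `n = p`, an alternating `e` and a subgroup `A ≤ E[p](K̄)`
with `#A ≤ p`: the additive Weil pairing vanishes on any two `S, T ∈ A` — a non-zero `S ∈ A` has order `p`, so
`ℤ·S` is ALL of `A` (counting) and `T = b•S`, `e(S, b•S) = b • e(S,S) = 0`. (At a BD-admissible prime `A = (F − 1)E[p]`
is the toric line.) [cite: SilvermanAEC2009, Prop. III.8.1] [cite: BertoliniDarmon2005, §2.2] -/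
theorem weilPairingHom_eq_zero_of_mem_of_card_le [Fact n.Prime] (halt : ∀ T, e T T = 1)
    (A : AddSubgroup (geomTorsion W n)) (hH : Nat.card A ≤ n)
    (S T : geomTorsion W n) (hS : S ∈ A) (hT : T ∈ A) :
    weilPairingHom W n e hμ hadd₁ hadd₂ S T = 0 := by
  by_cases hS0 : S = 0
  · rw [hS0, map_zero, AddMonoidHom.zero_apply]
  -- `S` has order `p` and generates `A`
  have hp : n.Prime := Fact.out
  have hord : addOrderOf S = n := addOrderOf_eq_prime (AddSubgroup.torsionBy.nsmul S) hS0
  haveI : Finite (geomTorsion W n) := finite_geomTorsion_of_neZero W n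
  haveI : Finite A := inferInstance
  have hle : AddSubgroup.zmultiples S ≤ A := AddSubgroup.zmultiples_le_of_mem hS
  have hcard : Nat.card A ≤ Nat.card (AddSubgroup.zmultiples S) := by
    rw [Nat.card_zmultiples, hord]
    exact hH
  have heq : AddSubgroup.zmultiples S = A := AddSubgroup.eq_of_le_of_card_ge hle hcard
  have hTS : T ∈ AddSubgroup.zmultiples S := by rw [heq]; exact hT
  obtain ⟨b, rfl⟩ := AddSubgroup.mem_zmultiples_iff.mp hTS
  rw [map_zsmul, weilPairingHom_self W n e hμ hadd₁ hadd₂ halt, smul_zero]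

end Toric

/-! ## §2 The two cardinality inputs at a Bertolini–Darmon admissible prime of a quadratic field -/

section Admissible

variable (W : WeierstrassCurve ℚ) [W.IsElliptic] [W.IsGloballyMinimal] (K : Type) [Field K] [NumberField K]
  (p : ℕ) [Fact p.Prime]

/-- **(H0)_p: `h⁰(K_w, E[p]) ≤ 1` at a Bertolini–Darmon admissible prime.** For `[K : ℚ] = 2`, `E = W/ℚ`, a BD
`1`-admissible prime `q` and the place `w ∣ q` of `K`: the `Γ_{K_w}`-invariants of `E[p](K̄)|_{Γ_{K_w}}` (restricted
module `GaloisRep.restrictField (w.adicCompletion K) …`) number AT MOST `p` — the hypothesis of koly g13's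
`natCard_galoisCohomology_one_torsion_le_sq` (`#H¹(K_w, E[p]) ≤ p²`, the hyperbolic plane). Proof: the Frobenius
`F` of the local picture at `𝔓_{ι₀,𝔐}` moves some point of `E(K̄)[p]` (sibling `exists_frob_of_isAdmissiblePrime`:
`Frob_q² ≠ 1`), and `F = res σ` for some `σ ∈ Γ_{K_w}` (Neukirch II (9.6),
`exists_apply_eq_smul_of_mem_decompositionSubgroup`), so the invariants are a proper subgroup of
`E(K̄)[p] ≅ (ℤ/p)²`. [cite: BertoliniDarmon2005, p. 18, §2.2] [cite: WZhang2014, Notations (xiv)]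
[cite: NeukirchANT1999, Ch. II §9 (9.6)] -/
theorem natCard_invariants_le_of_admQ (hK2 : Module.finrank ℚ K = 2) :
    ∀ (q : AdmQ W K p) (w : HeightOneSpectrum (𝓞 K)), ((q : ℕ) : 𝓞 K) ∈ w.asIdeal →
      Nat.card (GaloisRep.restrictField (w.adicCompletion K)
        ((W.baseChange K).torsionGaloisModule ((p ^ 1 : ℕ) : ℤ))).toTopRep.ρ.invariants ≤ p ^ 1 := by
  intro q w hqw
  rw [Nat.pow_one]
  have hp : p.Prime := Fact.out
  set ι₀ := closureEmb (K := K) (w.adicCompletion K) with hι₀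
  obtain ⟨𝔐, h𝔐⟩ := w.localPrimesAbove_nonempty
  have h𝔓 := HeightOneSpectrum.primeBelow_mem_primesAbove (ι := ι₀) h𝔐
  haveI := h𝔓.1
  obtain ⟨F, hF, ⟨P₁, hP₁⟩, -⟩ := exists_frob_of_isAdmissiblePrime W K hK2 q.2 w hqw h𝔐
  -- `F` is the restriction of some `σ ∈ Γ_{K_w}`
  obtain ⟨σ, hσ⟩ := exists_apply_eq_smul_of_mem_decompositionSubgroup ι₀ h𝔐 hF.mem_stabilizer
  have hresσ : resGal (K := K) (w.adicCompletion K) σ = F := by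
    rw [resGal_eq]
    exact resGalOfEmb_eq_of_apply_eq ι₀ hσ
  -- `σ` moves `P₁`, so the invariants are a proper subgroup of `E[p](K̄)` (order `p²`)
  set H := (GaloisRep.restrictField (w.adicCompletion K)
      ((W.baseChange K).torsionGaloisModule (p : ℤ))).toTopRep.ρ.invariants with hHdef
  have hPH : P₁ ∉ H := by
    intro hmem
    have h1 := (ContRepresentation.mem_invariants _).mp hmem σ
    apply hP₁
    have h2 : absGaloisRestrict K (w.adicCompletion K) σ • P₁ = P₁ := h1
    rwa [← resGal_eq_absGaloisRestrict, hresσ] at h2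
  have hHtop : H.toAddSubgroup ≠ ⊤ := by
    intro htop
    apply hPH
    have : P₁ ∈ H.toAddSubgroup := by rw [htop]; exact AddSubgroup.mem_top _
    exact this
  have hT : Nat.card (geomTorsion (W.baseChange K) (p : ℤ)) = p ^ 2 :=
    card_torsionPoints_eq_sq_holds (W.baseChange K) (AlgebraicClosure K) (n := p) (by exact_mod_cast hp.ne_zero)
  change Nat.card H.toAddSubgroup ≤ p
  exact natCard_le_of_ne_top hp hT hHtop

/-- **The toric line has order `≤ p` at a Bertolini–Darmon admissible prime.** For `[K : ℚ] = 2`, a BD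
`1`-admissible prime `q` and the place `w ∣ q`: the augmentation subgroup `⟨res τ · y − y : τ ∈ Γ_{K_w}⟩` of
`E(K̄)[p]` has AT MOST `p` elements. Proof: `res Γ_{K_w} = G_𝔓` for `𝔓 = 𝔓_{ι₀,𝔐}` (Neukirch II (9.6)), so the
subgroup is the augmentation subgroup of `G_𝔓`, which is `(F − 1)E[p]` for the Frobenius `F` of the local picture
(sibling `ToricFrob.closure_decomposition_eq_range`, inertia trivial at the good `w ∤ p`); and `F − 1` has a non-zero
kernel (sibling `exists_frob_of_isAdmissiblePrime`: the eigenvalue `±1` of `ρ̄(Frob_q)`), so its image is a proper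
subgroup. [cite: BertoliniDarmon2005, p. 18, §2.2–§2.3] [cite: WZhang2014, Notations (xiv), §4.1] -/
theorem natCard_augmentation_le_of_admQ (hK2 : Module.finrank ℚ K = 2) :
    ∀ (q : AdmQ W K p) (w : HeightOneSpectrum (𝓞 K)), ((q : ℕ) : 𝓞 K) ∈ w.asIdeal →
      Nat.card (AddSubgroup.closure {m : geomTorsion (W.baseChange K) ((p ^ 1 : ℕ) : ℤ) |
        ∃ (τ : absoluteGaloisGroup (w.adicCompletion K)) (y : geomTorsion (W.baseChange K) ((p ^ 1 : ℕ) : ℤ)),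
          m = resGal (K := K) (w.adicCompletion K) τ • y - y}) ≤ p ^ 1 := by
  intro q w hqw
  rw [Nat.pow_one]
  have hp : p.Prime := Fact.out
  obtain ⟨hgood, hpv⟩ := hasGoodReductionAt_of_isAdmissiblePrime W K q.2 w hqw
  set ι₀ := closureEmb (K := K) (w.adicCompletion K) with hι₀
  obtain ⟨𝔐, h𝔐⟩ := w.localPrimesAbove_nonempty
  have h𝔓 := HeightOneSpectrum.primeBelow_mem_primesAbove (ι := ι₀) h𝔐
  haveI := h𝔓.1
  obtain ⟨F, hF, -, P₂, hP₂0, hP₂⟩ := exists_frob_of_isAdmissiblePrime W K hK2 q.2 w hqw h𝔐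
  have hI : (w.primeBelow ι₀ 𝔐).inertia (absoluteGaloisGroup K) ≤ torsionFixing (W.baseChange K) (p : ℤ) :=
    inertia_le_torsionFixing (W.baseChange K) (fun h ↦ h hgood) hpv ι₀ h𝔐
  -- `res Γ_{K_w} = G_𝔓`: the two augmentation subgroups coincide
  have hlift : ∀ d ∈ (w.primeBelow ι₀ 𝔐).decompositionSubgroup (absoluteGaloisGroup K),
      ∃ σ : absoluteGaloisGroup (w.adicCompletion K), resGal (K := K) (w.adicCompletion K) σ = d := fun d hd ↦ by
    obtain ⟨σ, hσ⟩ := exists_apply_eq_smul_of_mem_decompositionSubgroup ι₀ h𝔐 hd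
    exact ⟨σ, by rw [resGal_eq]; exact resGalOfEmb_eq_of_apply_eq ι₀ hσ⟩
  have hresmem : ∀ g : absoluteGaloisGroup (w.adicCompletion K), resGal (K := K) (w.adicCompletion K) g ∈
      (w.primeBelow ι₀ 𝔐).decompositionSubgroup (absoluteGaloisGroup K) := fun g ↦ by
    rw [resGal_eq]; exact resGalOfEmb_mem_decompositionSubgroup ι₀ h𝔐 g
  have hset : {m : geomTorsion (W.baseChange K) (p : ℤ) |
        ∃ (τ : absoluteGaloisGroup (w.adicCompletion K)) (y : geomTorsion (W.baseChange K) (p : ℤ)),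
          m = resGal (K := K) (w.adicCompletion K) τ • y - y} =
      {m : geomTorsion (W.baseChange K) (p : ℤ) |
        ∃ d' ∈ (w.primeBelow ι₀ 𝔐).decompositionSubgroup (absoluteGaloisGroup K),
          ∃ x : geomTorsion (W.baseChange K) (p : ℤ), m = d' • x - x} := by
    ext m
    simp only [Set.mem_setOf_eq]
    constructor
    · rintro ⟨τ, y, rfl⟩
      exact ⟨_, hresmem τ, y, rfl⟩
    · rintro ⟨d', hd', x, rfl⟩
      obtain ⟨σ, rfl⟩ := hlift d' hd'
      exact ⟨σ, x, rfl⟩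
  rw [hset, ToricFrob.closure_decomposition_eq_range (W.baseChange K) h𝔓 (by exact_mod_cast hp.ne_zero) hF hI]
  have hT : Nat.card (geomTorsion (W.baseChange K) (p : ℤ)) = p ^ 2 :=
    card_torsionPoints_eq_sq_holds (W.baseChange K) (AlgebraicClosure K) (n := p) (by exact_mod_cast hp.ne_zero)
  refine natCard_range_le_of_exists_ker hp hT _ ⟨P₂, hP₂0, ?_⟩
  change F • P₂ - P₂ = 0
  rw [hP₂, sub_self]

end Admissible

end Summit.BirchSwinnertonDyer.BirchSwinnertonDyer.Theorems.AdditiveKoly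

end
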